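import Literature.MathematicalPhysics.QuantumManyBody.PeriodicBoseGas
import Literature.MathematicalPhysics.QuantumManyBody.PeriodicCellChangeOfVariables
import Literature.MathematicalPhysics.QuantumManyBody.PeriodicBoseGasFracEnergy
import Literature.MathematicalPhysics.QuantumManyBody.BoseGasFreeDirichletBEC
import Literature.MathematicalPhysics.QuantumManyBody.SwapPurity
import Mathlib.Algebra.Order.Chebyshev

/-!
# Route `BECThomsonPrinciple`, crux `PeriodicToDirichlet` (stmt-AtomisticToContinuum-9483),
# line `Sketch` (torus-in-the-box-doob): registered stub `stub_torusLocalCondensation`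

Local condensation from global on the torus: for a periodic trial state invariant under RIGID
translations of all particles, the constant-mode occupation is at most `k³` times the flat-mode
occupation of any sub-cube of side `L/k` of the cell. [folklore]

Proof. Write `N = n + 1`, `Q_q = (L/k)q + [0,L/k)³` (`q : Fin 3 → Fin k`) for the `k³` sub-cubes
partitioning the cell and `G_q(Y) = ∫_{Q_q} Ψ(x, Y) dx` (`Y ∈ (ℝ³)ⁿ`). Then
`n₀(Ψ) = N L⁻³ ∫_{cellⁿ} |∑_q G_q|²` and the flat occupation of `Q_j` is
`N (k/L)³ ∫_{cellⁿ} |G_j|²`.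
By Cauchy–Schwarz `|∑_q G_q|² ≤ k³ ∑_q |G_q|²`, and `∫_{cellⁿ} |G_q|² = ∫_{cellⁿ} |G_j|²` for every
`q`: translating the integration variable by `a = (L/k)(q - j)` and using the rigid invariance,
`G_q(Y) = G_j(Y - (a,…,a))`, and `G_j` is `Lℤ³`-periodic in every particle, so the shift of the
fundamental cell `cellⁿ` does not change the integral (`lintegral_cellN_comp_add`).
-/

noncomputable section

open MeasureTheory Filter
open scoped ENNReal NNReal

namespace Summit.AtomisticToContinuum.BoseEinsteinCondensation.TorusInTheBox

open Literature.MathematicalPhysics.QuantumManyBody.BoseGas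
open scoped ComplexConjugate

section Helpers

variable {n k : ℕ} {L : ℝ}

/-- The statement's sub-cube `{x | ∀ t, x_t - L j_t/k ∈ [0, L/k)}` is the tree's sub-cell
`subCell (L/k) j = (L/k)·j + [0,L/k)³`. [folklore] -/
private theorem setOf_eq_subCell (L : ℝ) (k : ℕ) (j : Fin 3 → Fin k) :
    {x : Space | ∀ t, x t - L * (j t : ℕ) / k ∈ Set.Ico 0 (L / k)} = subCell (L / k) j := by
  ext x
  rw [mem_subCell, Set.mem_setOf_eq]
  refine forall_congr' fun t => ?_
  have h : L * ((j t : ℕ) : ℝ) / k = L / k * ((j t : ℕ) : ℝ) := by ring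
  rw [h, Set.mem_Ico]
  constructor <;> rintro ⟨h1, h2⟩ <;> constructor <;> linarith

/-- `k · (L/k) = L`. [folklore] -/
private theorem cast_mul_div_cast (L : ℝ) (hk : 0 < k) : (k : ℝ) * (L / k) = L :=
  mul_div_cancel₀ L (Nat.cast_pos.mpr hk).ne'

/-- The `k³` sub-cells of side `L/k` cover the cell `[0,L)³`. [folklore] -/
private theorem iUnion_subCell_eq (hL : 0 < L) (hk : 0 < k) :
    ⋃ q : SubIdx k, subCell (L / k) q = cell L := by
  have hs : 0 < L / k := div_pos hL (Nat.cast_pos.mpr hk)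
  ext x
  simp only [Set.mem_iUnion]
  constructor
  · rintro ⟨q, hq⟩
    have h := subCell_subset_cell hs q hq
    rwa [cast_mul_div_cast L hk] at h
  · intro hx
    rw [← cast_mul_div_cast L hk] at hx
    exact exists_mem_subCell hs hx

/-- Every sub-cell lies in the cell. [folklore] -/
private theorem subCell_subset_cell' (hL : 0 < L) (hk : 0 < k) (q : SubIdx k) :
    subCell (L / k) q ⊆ cell L := by
  rw [← iUnion_subCell_eq hL hk]
  exact Set.subset_iUnion _ q

/-- Distinct sub-cells are disjoint. [folklore] -/
private theorem pairwise_disjoint_subCell (hs : 0 < L / k) :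
    Pairwise (Function.onFun Disjoint fun q : SubIdx k => subCell (L / k) q) := fun _ _ hqq' =>
  Set.disjoint_left.mpr fun _ hx => not_mem_subCell_of_ne hs hqq' hx

/-- The slice integrals `Y ↦ G_q(Y) = ∫_{Q_q} Ψ(x, Y) dx` are measurable for continuous `Ψ`.
[folklore] -/
private theorem measurable_sliceInt {Ψ : Config (n + 1) → ℂ} (hΨ : Continuous Ψ) (q : SubIdx k) :
    Measurable fun Y : Config n => ∫ x in subCell (L / k) q, Ψ (Matrix.vecCons x Y) := by
  have h : StronglyMeasurable
      (Function.uncurry fun (Y : Config n) (x : Space) => Ψ (Matrix.vecCons x Y)) :=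
    (hΨ.comp (continuous_snd.matrixVecCons continuous_fst)).stronglyMeasurable
  exact (h.integral_prod_right' (ν := volume.restrict (subCell (L / k) q))).measurable

/-- **The cell integral of a slice splits over the sub-cells**: `∫_cell Ψ(x,Y) dx = ∑_q G_q(Y)`.
[folklore] -/
private theorem setIntegral_cell_eq_sum_sliceInt (hL : 0 < L) (hk : 0 < k)
    {Ψ : Config (n + 1) → ℂ} (hΨ : Continuous Ψ) (Y : Config n) :
    ∫ x in cell L, Ψ (Matrix.vecCons x Y) =
      ∑ q : SubIdx k, ∫ x in subCell (L / k) q, Ψ (Matrix.vecCons x Y) := by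
  have hs : 0 < L / k := div_pos hL (Nat.cast_pos.mpr hk)
  rw [← iUnion_subCell_eq hL hk]
  exact integral_iUnion_fintype (fun q => measurableSet_subCell _ q)
    (pairwise_disjoint_subCell hs) fun q =>
      (integrableOn_cell (hΨ.comp (continuous_id.matrixVecCons continuous_const))).mono_set
        (subCell_subset_cell hs q)

/-- **Translation + rigid invariance**: `G_q(Y) = G_{q'}(Y - (a,…,a))`, `a = (L/k)(q - q')`.
[folklore] -/
private theorem sliceInt_eq_of_rigid {Ψ : Config (n + 1) → ℂ}
    (hrig : ∀ (a : Space) (X : Config (n + 1)), Ψ (fun l => X l + a) = Ψ X)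
    (q q' : SubIdx k) (Y : Config n) :
    ∫ x in subCell (L / k) q, Ψ (Matrix.vecCons x Y) =
      ∫ x in subCell (L / k) q', Ψ (Matrix.vecCons x
        (Y - fun _ : Fin n => subOffset (L / k) q - subOffset (L / k) q')) := by
  set a : Space := subOffset (L / k) q - subOffset (L / k) q' with ha
  unfold subCell
  calc ∫ x in cellShift (L / k) (subOffset (L / k) q), Ψ (Matrix.vecCons x Y)
      = ∫ x in cell (L / k), Ψ (Matrix.vecCons (x + subOffset (L / k) q) Y) :=
        (setIntegral_cell_comp_add (L / k) (fun x => Ψ (Matrix.vecCons x Y))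
          (subOffset (L / k) q)).symm
    _ = ∫ x in cell (L / k),
          Ψ (Matrix.vecCons (x + subOffset (L / k) q') (Y - fun _ : Fin n => a)) := by
        refine integral_congr_ae (Eventually.of_forall fun x => ?_)
        beta_reduce
        rw [← hrig a (Matrix.vecCons (x + subOffset (L / k) q') (Y - fun _ : Fin n => a))]
        congr 1
        funext l
        refine Fin.cases ?_ (fun m => ?_) l
        · simp only [Matrix.cons_val_zero, ha]
          abel
        · simp
    _ = ∫ x in cellShift (L / k) (subOffset (L / k) q'),
          Ψ (Matrix.vecCons x (Y - fun _ : Fin n => a)) :=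
        setIntegral_cell_comp_add (L / k) (fun x => Ψ (Matrix.vecCons x (Y - fun _ : Fin n => a)))
          (subOffset (L / k) q')

/-- `x :: (Y + e_m ⊗ u) = (x :: Y) + e_{m+1} ⊗ u`. [folklore] -/
private theorem cons_add_single_succ (x : Space) (Y : Config n) (m : Fin n) (u : Space) :
    (Matrix.vecCons x (Y + Pi.single m u) : Config (n + 1)) =
      Matrix.vecCons x Y + Pi.single m.succ u := by
  funext i
  refine Fin.cases ?_ (fun m' => ?_) i
  · simp [Ne.symm (Fin.succ_ne_zero m)]
  · by_cases h : m' = m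
    · subst h; simp
    · simp [h, Fin.succ_inj]

/-- `G_q` is `Lℤ³`-periodic in every spectator particle. [folklore] -/
private theorem sliceInt_add_single (Ψ : PeriodicTrialState (n + 1) L) (q : SubIdx k)
    (Y : Config n) (m : Fin n) (c : Fin 3) :
    ∫ x in subCell (L / k) q, Ψ.ψ (Matrix.vecCons x (Y + Pi.single m (EuclideanSpace.single c L))) =
      ∫ x in subCell (L / k) q, Ψ.ψ (Matrix.vecCons x Y) := by
  refine integral_congr_ae (Eventually.of_forall fun x => ?_)
  show Ψ.ψ (Matrix.vecCons x (Y + Pi.single m (EuclideanSpace.single c L))) =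
    Ψ.ψ (Matrix.vecCons x Y)
  rw [cons_add_single_succ, Ψ.periodic]

/-- **The key identity** `∫_{cellⁿ} |G_q|² = ∫_{cellⁿ} |G_{q'}|²` for a rigidly
translation-invariant periodic state (shift of the fundamental cell). [folklore] -/
private theorem lintegral_sliceInt_eq (hL : 0 < L) (Ψ : PeriodicTrialState (n + 1) L)
    (hrig : ∀ (a : Space) (X : Config (n + 1)), Ψ.ψ (fun l => X l + a) = Ψ.ψ X)
    (q q' : SubIdx k) :
    ∫⁻ Y in cellN n L, (‖∫ x in subCell (L / k) q, Ψ.ψ (Matrix.vecCons x Y)‖₊ : ℝ≥0∞) ^ 2 =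
      ∫⁻ Y in cellN n L, (‖∫ x in subCell (L / k) q', Ψ.ψ (Matrix.vecCons x Y)‖₊ : ℝ≥0∞) ^ 2 := by
  set a : Space := subOffset (L / k) q - subOffset (L / k) q' with ha
  calc ∫⁻ Y in cellN n L, (‖∫ x in subCell (L / k) q, Ψ.ψ (Matrix.vecCons x Y)‖₊ : ℝ≥0∞) ^ 2
      = ∫⁻ Y in cellN n L, (‖∫ x in subCell (L / k) q',
          Ψ.ψ (Matrix.vecCons x (Y + -fun _ : Fin n => a))‖₊ : ℝ≥0∞) ^ 2 := by
        refine lintegral_congr fun Y => ?_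
        rw [sliceInt_eq_of_rigid hrig q q' Y, sub_eq_add_neg]
    _ = ∫⁻ Y in cellN n L, (‖∫ x in subCell (L / k) q', Ψ.ψ (Matrix.vecCons x Y)‖₊ : ℝ≥0∞) ^ 2 :=
        lintegral_cellN_comp_add hL
          (G := fun Y => (‖∫ x in subCell (L / k) q', Ψ.ψ (Matrix.vecCons x Y)‖₊ : ℝ≥0∞) ^ 2)
          (fun Y m c => by simp only [sliceInt_add_single]) _

/-- `‖∑ᵢ aᵢ‖² ≤ #s · ∑ᵢ ‖aᵢ‖²` in `ℝ≥0∞` (Cauchy–Schwarz). [folklore] -/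
private theorem ennnorm_sum_sq_le {ι : Type*} (s : Finset ι) (a : ι → ℂ) :
    (‖∑ i ∈ s, a i‖₊ : ℝ≥0∞) ^ 2 ≤ (s.card : ℝ≥0∞) * ∑ i ∈ s, (‖a i‖₊ : ℝ≥0∞) ^ 2 := by
  have h1 : ‖∑ i ∈ s, a i‖₊ ≤ ∑ i ∈ s, ‖a i‖₊ := nnnorm_sum_le s a
  have h2 : (∑ i ∈ s, ‖a i‖₊) ^ 2 ≤ s.card * ∑ i ∈ s, ‖a i‖₊ ^ 2 := sq_sum_le_card_mul_sum_sq
  have h3 : ‖∑ i ∈ s, a i‖₊ ^ 2 ≤ s.card * ∑ i ∈ s, ‖a i‖₊ ^ 2 :=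
    (pow_le_pow_left' h1 2).trans h2
  have h4 : ((‖∑ i ∈ s, a i‖₊ ^ 2 : ℝ≥0) : ℝ≥0∞) ≤ ((s.card * ∑ i ∈ s, ‖a i‖₊ ^ 2 : ℝ≥0) : ℝ≥0∞) :=
    ENNReal.coe_le_coe.mpr h3
  push_cast at h4
  exact h4

/-- `‖(√v)⁻¹‖₊² = v⁻¹` in `ℝ≥0∞` for `v > 0`. [folklore] -/
private theorem ennnorm_inv_sqrt_sq {v : ℝ} (hv : 0 < v) :
    ((‖((Real.sqrt v : ℝ) : ℂ)⁻¹‖₊ : ℝ≥0∞)) ^ 2 = ENNReal.ofReal v⁻¹ := by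
  rw [coe_nnnorm_sq_eq_ofReal, norm_inv, Complex.norm_real,
    Real.norm_of_nonneg (Real.sqrt_nonneg _), inv_pow, Real.sq_sqrt hv.le]

end Helpers

/-- **Registered stub `stub_torusLocalCondensation`** (line `Sketch` of crux
stmt-AtomisticToContinuum-9483): `n₀(Ψ) ≤ k³ · n_{flat,C_j}(Ψ)` for every rigidly
translation-invariant periodic trial state `Ψ` and every sub-cube `C_j` of side `L/k` of the cell.
[folklore] -/
theorem stub_torusLocalCondensation :
    ∀ (N : ℕ) (L : ℝ), 0 < L → ∀ (k : ℕ), 0 < k → ∀ (j : Fin 3 → Fin k)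
      (Ψ : PeriodicTrialState N L),
      (∀ (a : Space) (X : Config N), Ψ.ψ (fun i => X i + a) = Ψ.ψ X) →
        condensateOccupation N L Ψ.ψ ≤ (k : ℝ≥0∞) ^ 3 *
          cellOccupation N L
            (Set.indicator {x : Space | ∀ t, x t - L * (j t : ℕ) / k ∈ Set.Ico 0 (L / k)}
              (fun _ => ((Real.sqrt ((L / k) ^ 3))⁻¹ : ℂ))) Ψ.ψ := by
  intro N L hL k hk j Ψ hrig
  cases N with
  | zero => simp [condensateOccupation, occupation]
  | succ n =>
  have hk' : (0 : ℝ) < k := Nat.cast_pos.mpr hk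
  have hΨc : Continuous Ψ.ψ := Ψ.contDiff.continuous
  -- the two normalisation constants
  set c₀ : ℂ := ((Real.sqrt (L ^ 3))⁻¹ : ℂ)
  set c₁ : ℂ := ((Real.sqrt ((L / k) ^ 3))⁻¹ : ℂ) with hc₁
  have hn₀ : ((‖c₀‖₊ : ℝ≥0∞)) ^ 2 = ENNReal.ofReal (L ^ 3)⁻¹ := ennnorm_inv_sqrt_sq (by positivity)
  have hn₁ : ((‖c₁‖₊ : ℝ≥0∞)) ^ 2 = (k : ℝ≥0∞) ^ 3 * ENNReal.ofReal (L ^ 3)⁻¹ := by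
    rw [hc₁, ennnorm_inv_sqrt_sq (by positivity), div_pow, inv_div, div_eq_mul_inv,
      ENNReal.ofReal_mul (by positivity), ENNReal.ofReal_pow hk'.le, ENNReal.ofReal_natCast]
  -- both sides through `cellOccupation_succ`
  have hLHS : condensateOccupation (n + 1) L Ψ.ψ = cellOccupation (n + 1) L (fun _ => c₀) Ψ.ψ := rfl
  rw [setOf_eq_subCell, hLHS, cellOccupation_succ, cellOccupation_succ]
  -- the inner integrals through the slice integrals `G_q(Y) = ∫_{Q_q} Ψ(x, Y) dx`
  have hpt₀ : ∀ Y : Config n,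
      (‖∫ x in cell L, conj c₀ * Ψ.ψ (Matrix.vecCons x Y)‖₊ : ℝ≥0∞) ^ 2 =
        (‖c₀‖₊ : ℝ≥0∞) ^ 2 *
          (‖∑ q : SubIdx k, ∫ x in subCell (L / k) q, Ψ.ψ (Matrix.vecCons x Y)‖₊ : ℝ≥0∞) ^ 2 := by
    intro Y
    rw [integral_const_mul, setIntegral_cell_eq_sum_sliceInt hL hk hΨc Y, nnnorm_mul,
      RCLike.nnnorm_conj, ENNReal.coe_mul, mul_pow]
  have hpt₁ : ∀ Y : Config n,
      (‖∫ x in cell L, conj ((subCell (L / k) j).indicator (fun _ => c₁) x) *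
          Ψ.ψ (Matrix.vecCons x Y)‖₊ : ℝ≥0∞) ^ 2 =
        (‖c₁‖₊ : ℝ≥0∞) ^ 2 *
          (‖∫ x in subCell (L / k) j, Ψ.ψ (Matrix.vecCons x Y)‖₊ : ℝ≥0∞) ^ 2 := by
    intro Y
    have hind : (fun x => conj ((subCell (L / k) j).indicator (fun _ => c₁) x) *
        Ψ.ψ (Matrix.vecCons x Y)) =
        (subCell (L / k) j).indicator fun x => conj c₁ * Ψ.ψ (Matrix.vecCons x Y) := by
      funext x
      by_cases hx : x ∈ subCell (L / k) j
      · simp [hx]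
      · simp [hx]
    rw [hind, integral_indicator (measurableSet_subCell _ j),
      Measure.restrict_restrict (measurableSet_subCell _ j),
      Set.inter_eq_left.mpr (subCell_subset_cell' hL hk j), integral_const_mul, nnnorm_mul,
      RCLike.nnnorm_conj, ENNReal.coe_mul, mul_pow]
  simp only [hpt₀, hpt₁]
  -- measurability, Cauchy–Schwarz and the key identity
  have hmeas : ∀ q : SubIdx k, Measurable fun Y : Config n =>
      (‖∫ x in subCell (L / k) q, Ψ.ψ (Matrix.vecCons x Y)‖₊ : ℝ≥0∞) ^ 2 :=
    fun q => (measurable_sliceInt hΨc q).nnnorm.coe_nnreal_ennreal.pow_const _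
  have hcard : ((Finset.univ : Finset (SubIdx k)).card : ℝ≥0∞) = (k : ℝ≥0∞) ^ 3 := by
    rw [Finset.card_univ, Fintype.card_fun, Fintype.card_fin, Fintype.card_fin]
    push_cast
    rfl
  have hCS : ∀ Y : Config n,
      (‖∑ q : SubIdx k, ∫ x in subCell (L / k) q, Ψ.ψ (Matrix.vecCons x Y)‖₊ : ℝ≥0∞) ^ 2 ≤
        (k : ℝ≥0∞) ^ 3 *
          ∑ q : SubIdx k, (‖∫ x in subCell (L / k) q, Ψ.ψ (Matrix.vecCons x Y)‖₊ : ℝ≥0∞) ^ 2 :=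
    fun Y => by
    have h := ennnorm_sum_sq_le Finset.univ
      (fun q : SubIdx k => ∫ x in subCell (L / k) q, Ψ.ψ (Matrix.vecCons x Y))
    rwa [hcard] at h
  have hkey : ∀ q : SubIdx k,
      ∫⁻ Y in cellN n L, (‖∫ x in subCell (L / k) q, Ψ.ψ (Matrix.vecCons x Y)‖₊ : ℝ≥0∞) ^ 2 =
        ∫⁻ Y in cellN n L, (‖∫ x in subCell (L / k) j, Ψ.ψ (Matrix.vecCons x Y)‖₊ : ℝ≥0∞) ^ 2 :=
    fun q => lintegral_sliceInt_eq hL Ψ hrig q j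
  have htop₀ : ((‖c₀‖₊ : ℝ≥0∞)) ^ 2 ≠ ⊤ := ENNReal.pow_ne_top ENNReal.coe_ne_top
  have htop₁ : ((‖c₁‖₊ : ℝ≥0∞)) ^ 2 ≠ ⊤ := ENNReal.pow_ne_top ENNReal.coe_ne_top
  have htopk : (k : ℝ≥0∞) ^ 3 ≠ ⊤ := ENNReal.pow_ne_top (ENNReal.natCast_ne_top k)
  calc (n + 1 : ℝ≥0∞) * ∫⁻ Y in cellN n L, (‖c₀‖₊ : ℝ≥0∞) ^ 2 *
          (‖∑ q : SubIdx k, ∫ x in subCell (L / k) q, Ψ.ψ (Matrix.vecCons x Y)‖₊ : ℝ≥0∞) ^ 2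
      ≤ (n + 1 : ℝ≥0∞) * ∫⁻ Y in cellN n L, (‖c₀‖₊ : ℝ≥0∞) ^ 2 * ((k : ℝ≥0∞) ^ 3 *
          ∑ q : SubIdx k,
            (‖∫ x in subCell (L / k) q, Ψ.ψ (Matrix.vecCons x Y)‖₊ : ℝ≥0∞) ^ 2) :=
        mul_le_mul_right (lintegral_mono fun Y => mul_le_mul_right (hCS Y) _) _
    _ = (n + 1 : ℝ≥0∞) * ((‖c₀‖₊ : ℝ≥0∞) ^ 2 * ((k : ℝ≥0∞) ^ 3 *
          ∑ q : SubIdx k, ∫⁻ Y in cellN n L,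
            (‖∫ x in subCell (L / k) q, Ψ.ψ (Matrix.vecCons x Y)‖₊ : ℝ≥0∞) ^ 2)) := by
        rw [lintegral_const_mul' _ _ htop₀, lintegral_const_mul' _ _ htopk,
          lintegral_finsetSum _ fun q _ => hmeas q]
    _ = (n + 1 : ℝ≥0∞) * ((‖c₀‖₊ : ℝ≥0∞) ^ 2 * ((k : ℝ≥0∞) ^ 3 * ((k : ℝ≥0∞) ^ 3 *
          ∫⁻ Y in cellN n L,
            (‖∫ x in subCell (L / k) j, Ψ.ψ (Matrix.vecCons x Y)‖₊ : ℝ≥0∞) ^ 2))) := by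
        simp only [hkey]
        rw [Finset.sum_const, nsmul_eq_mul, hcard]
    _ = (k : ℝ≥0∞) ^ 3 * ((n + 1 : ℝ≥0∞) * ∫⁻ Y in cellN n L, (‖c₁‖₊ : ℝ≥0∞) ^ 2 *
          (‖∫ x in subCell (L / k) j, Ψ.ψ (Matrix.vecCons x Y)‖₊ : ℝ≥0∞) ^ 2) := by
        rw [lintegral_const_mul' _ _ htop₁, hn₀, hn₁]
        ring

end Summit.AtomisticToContinuum.BoseEinsteinCondensation.TorusInTheBox

end
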